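import Mathlib
import HarnessLib
import Summits.NavierStokesRegularity.NavierStokesRegularity.Theorems.PoloidalWindowDoorLrcModEntireTwistingTHOscUniversalWeightCurvature
import Summits.NavierStokesRegularity.NavierStokesRegularity.Theorems.PoloidalWindowDoorLrcModEntireTwistingTHOscAncientLiouville

/-!
# Item `LrcModEntire` (stmt-NavierStokesRegularity-20428), CLASS road to `stub_twistingTHGerm` — THE ANCIENT LIOUVILLE THEOREM FOR (OSC) IN
# SIMILARITY VARIABLES, FOR EVERY COMPRESSION CONSTANT, WITH NO HYPOTHESIS OBJECT (composition of the LEAD's explicit weight with port-2's duality theorem)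

Cell ns-regularity-ideate, LEAD ns-poloidal-K2-p3 g13 (`--supports stmt-NavierStokesRegularity-20428`).  Composition BY NAME of
* `…TwistingTHOscUniversalWeightCurvature.exists_universalWeight₂` (this seat: for every `A > 0` an explicit even `C²` weight `w > 0` with
  `w″ + ½(ξ+s)w′ ≤ −γw` for all `|s| ≤ A`, `γ = e^{−A²/2}/16`, and Gaussian decay of `w, w′, w″`), and
* `…TwistingTHOscAncientLiouville.eq_zero_of_ancient_oscSubsolution_gaussian` (ns-k2-port-2 g3: given such a weight, every bounded non-negative
  eternal classical subsolution `Q` of `∂_τQ + ½∂_ξ((ξ + S)Q) ≤ ∂_ξξQ` with `|S| ≤ A` and polynomial bounds on `Q_τ, Q_ξ, Q_ξξ, S_ξ` vanishes).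
RESULT `eq_zero_of_ancient_oscSubsolution_anyK`: the same conclusion with the weight hypotheses DISCHARGED — the Liouville theorem for the similarity
form of the plane-oscillation law (OSC) holds for EVERY Lipschitz/polynomial bound on `S_ξ` (no «K < 1/2»: compare `…Endgame.eq_zero_of_dini_of_typeI`).
Reading for the column (memo OSC-LIOUVILLE-g13 §5): with `Q = Ô = √(−t)·osc_plane W` and `S = Ŝ = √(−t)·(M+m)` (`A = 2N`), the (TH) column of
`LrcModEntire` is reduced to (h1) the scale-invariant bound `Ô ≤ c` toward the past (the relocated wall) and (h2) the derivation of (OSC) in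
similarity variables with the stated regularity (touching/viscosity bookkeeping over `…Envelope.osc_divergence_form`).

WHAT THIS IS NOT: not a claim about Navier–Stokes regularity and not the stub — a theorem about a 1-D linear parabolic inequality (bears_on LADDER-NS N0,
item 20428 / crux 19708; both OPEN).
-/

noncomputable section

-- the summit and its single sub-problem share the name (CONVENTIONS §1), as in every Theorems file
set_option linter.dupNamespace false

namespace Summit.NavierStokesRegularity.NavierStokesRegularity.Theorems.PoloidalWindowDoorLrcModEntireTwistingTHOscLiouville

open Set Filter Topology
open Summit.NavierStokesRegularity.NavierStokesRegularity.Theorems.PoloidalWindowDoorLrcModEntireTwistingTHOscUniversalWeightCurvature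
open Summit.NavierStokesRegularity.NavierStokesRegularity.Theorems.PoloidalWindowDoorLrcModEntireTwistingTHOscAncientLiouville

/-- **ANCIENT LIOUVILLE FOR (OSC) IN SIMILARITY VARIABLES — EVERY COMPRESSION, NO WEIGHT HYPOTHESIS.**  Let `Q ≥ 0` be bounded (`Q ≤ c`) with
`Q(τ,·) ∈ C²`, time derivative `Qt` (continuous in `ξ`), and polynomial bounds `|Qt|, |Q_ξ|, |Q_ξξ| ≤ C(1+ξ²)^k`; let `S(τ,·) ∈ C¹` with `|S| ≤ A`
(`A > 0`) and `|S_ξ| ≤ C(1+ξ²)^k` — ANY `C`, `k`.  If `Qt + ½∂_ξ((ξ + S)Q) ≤ Q_ξξ` everywhere on `ℝ × ℝ` (eternal classical subsolution), then `Q ≡ 0`.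
Proof: `exists_universalWeight₂` (explicit weight, `γ = e^{−A²/2}/16`) fed into `eq_zero_of_ancient_oscSubsolution_gaussian`. -/
theorem eq_zero_of_ancient_oscSubsolution_anyK {Q Qt S : ℝ → ℝ → ℝ} {A c C : ℝ} {k : ℕ} (hA : 0 < A)
    (hQ2 : ∀ τ, ContDiff ℝ 2 (Q τ)) (hQt : ∀ τ ξ, HasDerivAt (fun τ' => Q τ' ξ) (Qt τ ξ) τ) (hQtc : ∀ τ, Continuous (Qt τ))
    (h0 : ∀ τ ξ, 0 ≤ Q τ ξ) (hc : ∀ τ ξ, Q τ ξ ≤ c)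
    (hQtb : ∀ τ ξ, |Qt τ ξ| ≤ C * (1 + ξ ^ 2) ^ k) (hQ1b : ∀ τ ξ, |deriv (Q τ) ξ| ≤ C * (1 + ξ ^ 2) ^ k)
    (hQ2b : ∀ τ ξ, |deriv (deriv (Q τ)) ξ| ≤ C * (1 + ξ ^ 2) ^ k)
    (hS : ∀ τ, ContDiff ℝ 1 (S τ)) (hSA : ∀ τ ξ, |S τ ξ| ≤ A) (hS1b : ∀ τ ξ, |deriv (S τ) ξ| ≤ C * (1 + ξ ^ 2) ^ k)
    (hsub : ∀ τ ξ, Qt τ ξ + (1 / 2 : ℝ) * deriv (fun ξ => (ξ + S τ ξ) * Q τ ξ) ξ ≤ deriv (deriv (Q τ)) ξ) :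
    ∀ τ ξ, Q τ ξ = 0 := by
  obtain ⟨γ, κ, Cw, hγ, hκ, _hCw, w, hw2, _heven, hpos, _hmono, hineq, hdec, hdec', hdec''⟩ := exists_universalWeight₂ hA
  exact eq_zero_of_ancient_oscSubsolution_gaussian hw2 hpos hγ hineq hκ hdec hdec' hdec'' hQ2 hQt hQtc h0 hc hQtb hQ1b hQ2b hS hSA hS1b hsub

/-- **The self-contained «no K» statement for the record** (bounded `S` with an arbitrary bound `A`, possibly `≤ 0`): replace `A` by
`max A 1 > 0`. -/
theorem eq_zero_of_ancient_oscSubsolution_anyK' {Q Qt S : ℝ → ℝ → ℝ} {A c C : ℝ} {k : ℕ}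
    (hQ2 : ∀ τ, ContDiff ℝ 2 (Q τ)) (hQt : ∀ τ ξ, HasDerivAt (fun τ' => Q τ' ξ) (Qt τ ξ) τ) (hQtc : ∀ τ, Continuous (Qt τ))
    (h0 : ∀ τ ξ, 0 ≤ Q τ ξ) (hc : ∀ τ ξ, Q τ ξ ≤ c)
    (hQtb : ∀ τ ξ, |Qt τ ξ| ≤ C * (1 + ξ ^ 2) ^ k) (hQ1b : ∀ τ ξ, |deriv (Q τ) ξ| ≤ C * (1 + ξ ^ 2) ^ k)
    (hQ2b : ∀ τ ξ, |deriv (deriv (Q τ)) ξ| ≤ C * (1 + ξ ^ 2) ^ k)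
    (hS : ∀ τ, ContDiff ℝ 1 (S τ)) (hSA : ∀ τ ξ, |S τ ξ| ≤ A) (hS1b : ∀ τ ξ, |deriv (S τ) ξ| ≤ C * (1 + ξ ^ 2) ^ k)
    (hsub : ∀ τ ξ, Qt τ ξ + (1 / 2 : ℝ) * deriv (fun ξ => (ξ + S τ ξ) * Q τ ξ) ξ ≤ deriv (deriv (Q τ)) ξ) :
    ∀ τ ξ, Q τ ξ = 0 :=
  eq_zero_of_ancient_oscSubsolution_anyK (A := max A 1) (lt_of_lt_of_le one_pos (le_max_right A 1)) hQ2 hQt hQtc h0 hc hQtb hQ1b hQ2b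
    hS (fun τ ξ => (hSA τ ξ).trans (le_max_left A 1)) hS1b hsub

end Summit.NavierStokesRegularity.NavierStokesRegularity.Theorems.PoloidalWindowDoorLrcModEntireTwistingTHOscLiouville
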